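import Literature.Probability.LatticeModels.IsingLaceTheta
import Literature.Probability.LatticeModels.IsingLaceFirstExpansion
import HarnessLib

/-!
# Completion of Sakai's lace expansion (§2.2.3 of Sakai 2007): Proposition 1.1 from the
# second-expansion identity (2.35)

Topic `Probability/LatticeModels`, grouping namespace `IsingLace` (continuation of
`IsingLaceCoefficients.lean`, `IsingLaceThrough.lean`, `IsingLaceTheta.lean`).

Sakai 2007 proves Proposition 1.1 (the lace expansion (1.11) with the bounds (1.13)) in three
steps: the first expansion (§2.2.1, (2.16)), the second expansion (§2.2.2, (2.35)):

`⟨φ_vφ_x⟩_Λ - ⟨φ_vφ_x⟩_{𝒜ᶜ} = Θ_{v,x;𝒜} + Σ_b Θ_{v,b̲;𝒜} τ_b ⟨φ_{b̄}φ_x⟩_Λ - Σ_b Θ_{v,b̲;𝒜}[τ_b(⟨φ_{b̄}φ_x⟩_Λ - ⟨φ_{b̄}φ_x⟩_{𝒞^b(v)ᶜ})]`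

for every `𝒜` and `v, x` (which contains the first expansion as the case `𝒜 = Λ`, where
`⟨·⟩_{∅} = 0`, `Θ_{o,x;Λ} = π^{(0)}_Λ(x)` (2.36) and the last sum is `R^{(1)}_Λ(x)` (2.37)), and the
completion (§2.2.3): "By repeated applications of (2.35) to the remainder `R^{(j)}_Λ(x)`, we
obtain (1.11)–(1.12)", i.e. substituting (2.35) into the innermost level of the nested remainder
(2.40) and expanding `Θ` linearly ((2.41)–(2.42)), plus the ferromagnetic bounds (1.13) ("we
simply ignore `⟨φ_{b̄_j}φ_x⟩_{𝒞̃ᶜ_{j-1}}` in (2.40)").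

This file VENDORS the second-expansion identity (2.35) for the tree's objects as the named fact
`Sakai2007_secondExpansion` (its printed proof — the pivotal-bond decomposition (2.29), the
parity alternation (2.31) and the conditioning on the cluster `𝒞^b_{m+n}(v)` (2.32)–(2.34), on top
of Proposition 2.2 which is the tree's `IsingLace.twoPoint_sub_twoPointOff_eq_tsum` — is random-
current combinatorics not yet in the tree), and PROVES the completion:

* `sum_theta_nest` — the linear-algebra step (2.41) ⟶ (2.42): substituting an identity of the
  shape `F = P + Σ_{b'} P(·,b̲') τ_{b'} ⟨φ_{b̄'}φ_x⟩_Λ - R` into `Σ_b Θ_{v,b̲;𝒜}[τ_b F(𝒞^b(v), b̄, x)]`;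
* `rKernel_eq_of_secondExpansionAt` — for every nesting depth `k` and every `(𝒜, v, x)`:
  `R_k(𝒜,v,x) = P_{k+1}(𝒜,v,x) + Σ_{b'} P_{k+1}(𝒜,v,b̲') τ_{b'}⟨φ_{b̄'}φ_x⟩_Λ - R_{k+1}(𝒜,v,x)`
  (`P_k = piKernel k`, `R_k = rKernel k`; (2.42) is `k = 0`, `𝒜 = Λ`, `v = o`);
* `rKernel_le_sum` — the upper bound of (1.13) at every depth (`π^{(0)}_Λ(o) = 1` is the tree's
  `coeff_zero_self` of `IsingLaceFirstExpansion.lean`, where Proposition 1.1 at `j = 0` is proved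
  directly from the first expansion (2.16));
* **`Sakai2007_prop11_of_secondExpansion : Sakai2007_secondExpansion → Sakai2007_prop11`**.

So the tree's named fact `IsingLace.Sakai2007_prop11` (hence, with `Sakai2007_prop31`, the
barrier input `Sakai2007_laceExpansionBounds`, file
`Barriers/CriticalPhenomena/LaceExpansionIsingCoefficients.lean`) is reduced to (2.35).

Status of the proof campaign for (2.35) (two literature-prover units converge on it): its
ingredients land in `IsingLaceThrough.lean` (Proposition 2.2, proved) and in
`IsingLaceFirstPivotal.lean`, `IsingLaceParity.lean`, `IsingLaceConditioning.lean`,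
`IsingLaceFirstExpansion.lean` (the first expansion (2.9)–(2.18), proved — the `𝒜 = Λ` case of
(2.35), `prop11_zero`); still to come are the `𝒜`-relative decomposition (2.29) with the event
`E_N(v,x;𝒜)` (`IsingLace.laceEvent`), the parity and conditioning steps for pairs `(m, n)` with `m`
living on `𝔹_{𝒜ᶜ}` ((2.31)–(2.34)), and the assembly of `SecondExpansionAt` in terms of `theta`.

## References

* A. Sakai, *Lace expansion for the Ising model*, Comm. Math. Phys. 272 (2007) 283–344,
  arXiv:math-ph/0510093: Proposition 1.1 ((1.11)–(1.13)); §2.2.2 ((2.28)–(2.35));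
  §2.2.3 ((2.36)–(2.42) and the last paragraph) [Sakai2007].
* A. Sakai, *Correct bounds on the Ising lace-expansion coefficients*, Comm. Math. Phys. 392
  (2022) 783–823, arXiv:2003.09856: §2.5 ("the rest of that paper is secure") [Sakai2022].
(Equation numbers are those of the arXiv versions held in the literature store, every display
counted.)
-/

noncomputable section

open Finset
open scoped symmDiff BigOperators

namespace Literature.Probability.LatticeModels

variable {V : Type*} [Fintype V] [DecidableEq V] (G : SimpleGraph V) [DecidableRel G.Adj]

namespace IsingLace

/-! ## The second-expansion identity (2.35) as a named fact -/

/-- **The second-expansion identity (2.35) of Sakai 2007 at `(G, β)`**, for all removed sets `𝒜`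
and all `v, x`:
`⟨φ_vφ_x⟩_Λ - ⟨φ_vφ_x⟩_{𝒜ᶜ} = Θ_{v,x;𝒜} + Σ_b Θ_{v,b̲;𝒜} τ_b ⟨φ_{b̄}φ_x⟩_Λ - Σ_b Θ_{v,b̲;𝒜}[τ_b (⟨φ_{b̄}φ_x⟩_Λ - ⟨φ_{b̄}φ_x⟩_{𝒞^b(v)ᶜ})]`,
where `Θ_{v,x;𝒜} = Θ_{v,x;𝒜}[1]` ((2.30), the tree's `IsingLace.theta`), `b` runs over the directed
bonds of `𝔹_Λ`, `τ_b = tanh β`, and `𝒞^b(v) = 𝒞^b_{m+n}(v)` "is a variable for the operation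
`Θ_{v,b̲;𝒜}`" (`IsingLace.clusterOff`). The three terms are `piKernel G β 0 𝒜 v x`, the bond sum
of `piKernel G β 0 𝒜 v b̲`, and `rKernel G β 0 𝒜 v x` by definition ((2.39)–(2.40)).
[cite: Sakai2007, (2.35) with (2.30), (2.37), (2.39)–(2.40)] -/
def SecondExpansionAt (β : ℝ) : Prop :=
  ∀ (A : Finset V) (v x : V),
    isingTwoPoint G univ β 0 .free v x - twoPointOff G β A v x =
      theta G β A v x (fun _ => 1) +
        (∑ d : G.Dart, theta G β A v d.fst (fun _ => 1) * Real.tanh β *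
          isingTwoPoint G univ β 0 .free d.snd x) -
        ∑ d : G.Dart, theta G β A v d.fst (fun N => Real.tanh β *
          (isingTwoPoint G univ β 0 .free d.snd x -
            twoPointOff G β (clusterOff G N (dartEdge G d) v) d.snd x))

/-- NAMED FACT — **Sakai 2007, the second expansion (2.35)** ("By (2.30)–(2.34), we arrive at
(2.35) … This completes the second stage of the expansion"), for the Ising model with uniform
ferromagnetic coupling `β ≥ 0` on a finite simple graph and every `(𝒜, v, x)`: the statement
`SecondExpansionAt G β`. Printed proof (§2.2.2): Proposition 2.2 ((2.19); the tree's
`IsingLace.twoPoint_sub_twoPointOff_eq_tsum`), the decomposition of `1{v ⟷ x through 𝒜}` by the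
first pivotal bond `b` with `v ⟷ b̲ through 𝒜` into the event `E_N(v,x;𝒜)` ((2.28)–(2.29)), the
parity alternation of `n_b` against the factor `τ_b` ((2.31)), the conditioning on
`𝒞^b_{m+n}(v) = ℬ` with the decoupling of the currents inside and outside `ℬ` ((2.32)–(2.33)), and
the removal of "off `b`" and of the parity constraints ((2.34)). As for Proposition 1.1 in the
tree, only the ferromagnetic uniform coupling is transcribed (the identity is printed for every
coupling; stating it for `β ≥ 0` is weaker). Not proved here.
[cite: Sakai2007, §2.2.2, (2.28)–(2.35)] [cite: Sakai2022, §2.5] -/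
def Sakai2007_secondExpansion : Prop :=
  ∀ (V : Type) [Fintype V] [DecidableEq V] (G : SimpleGraph V) [DecidableRel G.Adj] (β : ℝ),
    0 ≤ β → SecondExpansionAt G β

variable {G} {β : ℝ}

/-! ## The completion of the expansion (§2.2.3) -/

/-- **The substitution step (2.41) ⟶ (2.42)**: if `F(𝒜',v',x') = P(𝒜',v',x') +
Σ_{b'} P(𝒜',v',b̲') τ_{b'} ⟨φ_{b̄'}φ_{x'}⟩_Λ - R(𝒜',v',x')` for all `(𝒜',v',x')`, with `P`, `R`
bounded, then substituting into `Σ_b Θ_{v,b̲;𝒜}[τ_b F(𝒞^b(v), b̄, x)]` and expanding `Θ` linearly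
gives `P⁺(𝒜,v,x) + Σ_{b'} P⁺(𝒜,v,b̲') τ_{b'}⟨φ_{b̄'}φ_x⟩_Λ - R⁺(𝒜,v,x)`, where
`P⁺(𝒜,v,y) = Σ_b Θ_{v,b̲;𝒜}[τ_b P(𝒞^b(v), b̄, y)]` is the next nesting level of `P` (and likewise
`R⁺`). [cite: Sakai2007, §2.2.3 ((2.38), (2.41)–(2.42))] -/
theorem sum_theta_nest {F P R : Finset V → V → V → ℝ} {CP CR : ℝ}
    (hPb : ∀ A v x, |P A v x| ≤ CP) (hRb : ∀ A v x, |R A v x| ≤ CR)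
    (hF : ∀ A v x, F A v x = P A v x +
      (∑ d : G.Dart, P A v d.fst * Real.tanh β * isingTwoPoint G univ β 0 .free d.snd x) - R A v x)
    (A : Finset V) (v x : V) :
    ∑ d : G.Dart, theta G β A v d.fst
        (fun N => Real.tanh β * F (clusterOff G N (dartEdge G d) v) d.snd x) =
      (∑ d : G.Dart, theta G β A v d.fst
          (fun N => Real.tanh β * P (clusterOff G N (dartEdge G d) v) d.snd x)) +
        (∑ d' : G.Dart, (∑ d : G.Dart, theta G β A v d.fst
            (fun N => Real.tanh β * P (clusterOff G N (dartEdge G d) v) d.snd d'.fst)) *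
          Real.tanh β * isingTwoPoint G univ β 0 .free d'.snd x) -
        ∑ d : G.Dart, theta G β A v d.fst
          (fun N => Real.tanh β * R (clusterOff G N (dartEdge G d) v) d.snd x) := by
  have hτ := abs_tanh_le_one β
  have hCP : 0 ≤ CP := (abs_nonneg _).trans (hPb ∅ v x)
  -- boundedness of the substituted pieces
  have hbP : ∀ (d : G.Dart) (y : V), ∃ C, ∀ N : Current G,
      |Real.tanh β * P (clusterOff G N (dartEdge G d) v) d.snd y| ≤ C := fun d y =>
    ⟨CP, fun N => by
      rw [abs_mul]
      exact (mul_le_mul (hτ) (hPb _ _ _) (abs_nonneg _) zero_le_one).trans (one_mul _).le⟩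
  have hbR : ∀ d : G.Dart, ∃ C, ∀ N : Current G,
      |Real.tanh β * R (clusterOff G N (dartEdge G d) v) d.snd x| ≤ C := fun d =>
    ⟨CR, fun N => by
      rw [abs_mul]
      exact (mul_le_mul (hτ) (hRb _ _ _) (abs_nonneg _) zero_le_one).trans (one_mul _).le⟩
  have hbS : ∀ d : G.Dart, ∃ C, ∀ N : Current G,
      |∑ d' : G.Dart, Real.tanh β * P (clusterOff G N (dartEdge G d) v) d.snd d'.fst *
        (Real.tanh β * isingTwoPoint G univ β 0 .free d'.snd x)| ≤ C := fun d =>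
    ⟨∑ _d' : G.Dart, CP, fun N => (Finset.abs_sum_le_sum_abs _ _).trans
      (Finset.sum_le_sum fun d' _ => by
        rw [abs_mul, abs_mul, abs_mul]
        have h1 := hPb (clusterOff G N (dartEdge G d) v) d.snd d'.fst
        have h2 := abs_isingTwoPoint_le_one G univ β 0 .free d'.snd x
        have h3 : 0 ≤ |P (clusterOff G N (dartEdge G d) v) d.snd d'.fst| := abs_nonneg _
        have h4 : 0 ≤ |isingTwoPoint G univ β 0 .free d'.snd x| := abs_nonneg _
        have h5 : 0 ≤ |Real.tanh β| := abs_nonneg _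
        nlinarith [mul_le_mul hτ h1 h3 zero_le_one, mul_le_mul hτ h2 h4 zero_le_one,
          mul_nonneg h5 h3, mul_nonneg h5 h4])⟩
  -- the pointwise substitution inside each `Θ_{v,b̲;𝒜}` and the linear expansion
  have hd : ∀ d : G.Dart, theta G β A v d.fst
      (fun N => Real.tanh β * F (clusterOff G N (dartEdge G d) v) d.snd x) =
      theta G β A v d.fst (fun N => Real.tanh β * P (clusterOff G N (dartEdge G d) v) d.snd x) +
        (∑ d' : G.Dart, theta G β A v d.fst
          (fun N => Real.tanh β * P (clusterOff G N (dartEdge G d) v) d.snd d'.fst) *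
            (Real.tanh β * isingTwoPoint G univ β 0 .free d'.snd x)) -
        theta G β A v d.fst (fun N => Real.tanh β * R (clusterOff G N (dartEdge G d) v) d.snd x) := by
    intro d
    have hfun : (fun N => Real.tanh β * F (clusterOff G N (dartEdge G d) v) d.snd x) =
        fun N => (Real.tanh β * P (clusterOff G N (dartEdge G d) v) d.snd x +
          ∑ d' : G.Dart, Real.tanh β * P (clusterOff G N (dartEdge G d) v) d.snd d'.fst *
            (Real.tanh β * isingTwoPoint G univ β 0 .free d'.snd x)) -
          Real.tanh β * R (clusterOff G N (dartEdge G d) v) d.snd x := by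
      funext N
      rw [hF, mul_sub, mul_add, Finset.mul_sum]
      congr 2
      exact Finset.sum_congr rfl fun d' _ => by ring
    obtain ⟨C1, hC1⟩ := hbP d x
    obtain ⟨C2, hC2⟩ := hbS d
    have hbPS : ∃ C, ∀ N : Current G, |Real.tanh β * P (clusterOff G N (dartEdge G d) v) d.snd x +
        ∑ d' : G.Dart, Real.tanh β * P (clusterOff G N (dartEdge G d) v) d.snd d'.fst *
          (Real.tanh β * isingTwoPoint G univ β 0 .free d'.snd x)| ≤ C :=
      ⟨C1 + C2, fun N => (abs_add_le _ _).trans (add_le_add (hC1 N) (hC2 N))⟩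
    rw [hfun, theta_sub hbPS (hbR d), theta_add ⟨C1, hC1⟩ ⟨C2, hC2⟩,
      theta_sum_mul (fun d' : G.Dart => hbP d d'.fst)]
  rw [Finset.sum_congr rfl fun d _ => hd d, Finset.sum_sub_distrib, Finset.sum_add_distrib,
    Finset.sum_comm]
  congr 2
  refine Finset.sum_congr rfl fun d' _ => ?_
  rw [Finset.sum_mul, Finset.sum_mul]
  exact Finset.sum_congr rfl fun d _ => by ring

/-- **The nesting identity at every depth** ((2.42) iterated): granted (2.35) at `(G, β)`, for
every `k`, `𝒜`, `v`, `x`,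
`R_k(𝒜,v,x) = P_{k+1}(𝒜,v,x) + Σ_{b'} P_{k+1}(𝒜,v,b̲') τ_{b'} ⟨φ_{b̄'}φ_x⟩_Λ - R_{k+1}(𝒜,v,x)`
with `P_k = piKernel k`, `R_k = rKernel k` — "by repeated applications of (2.35) to the
remainder". [cite: Sakai2007, §2.2.3 ((2.38)–(2.42))] -/
theorem rKernel_eq_of_secondExpansionAt (hβ : 0 ≤ β) (h2 : SecondExpansionAt G β) (k : ℕ)
    (A : Finset V) (v x : V) :
    rKernel G β k A v x = piKernel G β (k + 1) A v x +
      (∑ d : G.Dart, piKernel G β (k + 1) A v d.fst * Real.tanh β *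
        isingTwoPoint G univ β 0 .free d.snd x) -
      rKernel G β (k + 1) A v x := by
  induction k generalizing A v x with
  | zero =>
    have h := sum_theta_nest (G := G) (β := β)
      (F := fun A v x => isingTwoPoint G univ β 0 .free v x - twoPointOff G β A v x)
      (P := fun A v x => piKernel G β 0 A v x) (R := fun A v x => rKernel G β 0 A v x)
      (abs_piKernel_le_pow hβ 0) (abs_rKernel_le_pow hβ 0)
      (fun A v x => by simp only [h2 A v x, piKernel.eq_1, rKernel.eq_1]) A v x
    rw [rKernel.eq_1, piKernel.eq_2, rKernel.eq_2]
    simpa only [piKernel.eq_2] using h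
  | succ k ih =>
    have h := sum_theta_nest (G := G) (β := β)
      (F := fun A v x => rKernel G β k A v x)
      (P := fun A v x => piKernel G β (k + 1) A v x) (R := fun A v x => rKernel G β (k + 1) A v x)
      (abs_piKernel_le_pow hβ (k + 1)) (abs_rKernel_le_pow hβ (k + 1))
      (fun A v x => ih A v x) A v x
    rw [rKernel.eq_2, piKernel.eq_2, rKernel.eq_2]
    simpa only [piKernel.eq_2] using h

/-- **The upper bound of (1.13) at every depth**: for `β ≥ 0`,
`R_k(𝒜,v,x) ≤ Σ_b P_k(𝒜,v,b̲) τ_b ⟨φ_{b̄}φ_x⟩_Λ` — "we simply ignore `⟨φ_{b̄_j}φ_x⟩_{𝒞̃ᶜ_{j-1}}`"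
at the innermost level (it is nonnegative) and pull the constant `τ_b⟨φ_{b̄}φ_x⟩_Λ` out of `Θ`.
[cite: Sakai2007, Proposition 1.1 ((1.13)) and §2.2.3 (last paragraph)] -/
theorem rKernel_le_sum (hβ : 0 ≤ β) (k : ℕ) :
    ∀ (A : Finset V) (v x : V), rKernel G β k A v x ≤
      ∑ d : G.Dart, piKernel G β k A v d.fst * Real.tanh β * isingTwoPoint G univ β 0 .free d.snd x := by
  have hτ := abs_tanh_le_one β
  have hτ0 := tanh_nonneg_of_nonneg hβ
  induction k with
  | zero =>
    intro A v x
    rw [rKernel.eq_1]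
    refine Finset.sum_le_sum fun d _ => ?_
    rw [piKernel.eq_1]
    calc theta G β A v d.fst (fun N => Real.tanh β *
          (isingTwoPoint G univ β 0 .free d.snd x -
            twoPointOff G β (clusterOff G N (dartEdge G d) v) d.snd x))
        ≤ theta G β A v d.fst (fun _ => Real.tanh β * isingTwoPoint G univ β 0 .free d.snd x) := by
          refine theta_mono hβ ⟨1, fun N => ?_⟩ ⟨1, fun N => ?_⟩ fun N => ?_
          · rw [abs_mul]
            exact (mul_le_mul hτ (abs_twoPoint_sub_twoPointOff_le_one hβ _ _ _) (abs_nonneg _)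
              zero_le_one).trans (one_mul _).le
          · rw [abs_mul]
            exact (mul_le_mul hτ (abs_isingTwoPoint_le_one G univ β 0 .free d.snd x)
              (abs_nonneg _) zero_le_one).trans (one_mul _).le
          · exact mul_le_mul_of_nonneg_left (sub_le_self _ (twoPointOff_nonneg hβ _ _ _)) hτ0
      _ = theta G β A v d.fst (fun _ => 1) * Real.tanh β * isingTwoPoint G univ β 0 .free d.snd x := by
          rw [theta_const]; ring
  | succ k ih =>
    intro A v x
    rw [rKernel.eq_2]
    have hbP : ∀ (d : G.Dart) (y : V), ∃ C, ∀ N : Current G,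
        |Real.tanh β * piKernel G β k (clusterOff G N (dartEdge G d) v) d.snd y| ≤ C := fun d y =>
      ⟨(Fintype.card G.Dart : ℝ) ^ k, fun N => by
        rw [abs_mul]
        exact (mul_le_mul hτ (abs_piKernel_le_pow hβ k _ _ _) (abs_nonneg _) zero_le_one).trans
          (one_mul _).le⟩
    calc ∑ d : G.Dart, theta G β A v d.fst
          (fun N => Real.tanh β * rKernel G β k (clusterOff G N (dartEdge G d) v) d.snd x)
        ≤ ∑ d : G.Dart, theta G β A v d.fst (fun N => ∑ d' : G.Dart,
            Real.tanh β * piKernel G β k (clusterOff G N (dartEdge G d) v) d.snd d'.fst *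
              (Real.tanh β * isingTwoPoint G univ β 0 .free d'.snd x)) := by
          refine Finset.sum_le_sum fun d _ =>
            theta_mono hβ ⟨(Fintype.card G.Dart : ℝ) ^ (k + 1), fun N => ?_⟩
              ⟨(Fintype.card G.Dart : ℝ) * (Fintype.card G.Dart : ℝ) ^ k, fun N => ?_⟩ fun N => ?_
          · rw [abs_mul]
            exact (mul_le_mul hτ (abs_rKernel_le_pow hβ k _ _ _) (abs_nonneg _)
              zero_le_one).trans (one_mul _).le
          · refine (Finset.abs_sum_le_sum_abs _ _).trans
              ((Finset.sum_le_sum (g := fun _ => (Fintype.card G.Dart : ℝ) ^ k)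
                fun d' _ => ?_).trans (le_of_eq ?_))
            swap
            · rw [Finset.sum_const, Finset.card_univ, nsmul_eq_mul]
            rw [abs_mul, abs_mul, abs_mul, abs_of_nonneg (piKernel_nonneg hβ k _ _ _)]
            have h1 := piKernel_le_pow (G := G) hβ k (clusterOff G N (dartEdge G d) v) d.snd d'.fst
            have h2 := abs_isingTwoPoint_le_one G univ β 0 .free d'.snd x
            have h3 := piKernel_nonneg (G := G) hβ k (clusterOff G N (dartEdge G d) v) d.snd d'.fst
            have h4 : 0 ≤ |isingTwoPoint G univ β 0 .free d'.snd x| := abs_nonneg _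
            have h5 : 0 ≤ |Real.tanh β| := abs_nonneg _
            calc |Real.tanh β| * piKernel G β k (clusterOff G N (dartEdge G d) v) d.snd d'.fst *
                  (|Real.tanh β| * |isingTwoPoint G univ β 0 .free d'.snd x|)
                ≤ 1 * (Fintype.card G.Dart : ℝ) ^ k * (1 * 1) := by
                  refine mul_le_mul (mul_le_mul hτ h1 h3 zero_le_one)
                    (mul_le_mul hτ h2 h4 zero_le_one) (mul_nonneg h5 h4) (by positivity)
              _ = (Fintype.card G.Dart : ℝ) ^ k := by ring
          · refine (mul_le_mul_of_nonneg_left (ih _ _ _) hτ0).trans (le_of_eq ?_)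
            rw [Finset.mul_sum]
            exact Finset.sum_congr rfl fun d' _ => by ring
      _ = ∑ d' : G.Dart, piKernel G β (k + 1) A v d'.fst * Real.tanh β *
            isingTwoPoint G univ β 0 .free d'.snd x := by
          rw [Finset.sum_congr rfl fun d _ => theta_sum_mul (fun d' : G.Dart => hbP d d'.fst) _,
            Finset.sum_comm]
          refine Finset.sum_congr rfl fun d' _ => ?_
          rw [piKernel.eq_2, Finset.sum_mul, Finset.sum_mul]
          exact Finset.sum_congr rfl fun d _ => by ring

/-- **Sakai 2007, Proposition 1.1 from the second-expansion identity (2.35)** (the completion of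
the lace expansion, §2.2.3): the identity (1.11) for every `j` by induction ("repeated
applications of (2.35) to the remainder", `rKernel_eq_of_secondExpansionAt` at `𝒜 = Λ`, `v = o`,
where `⟨·⟩_{Λᶜ} = 0`), and the bounds (1.13): `π^{(j)} ≥ δ_{j,0}δ_{o,x}` (nonnegative weights and
`π^{(0)}_Λ(o) = 1`), `0 ≤ R^{(j+1)}` (Proposition 2.2), `R^{(j+1)} ≤ Σ_{u,v} π^{(j)}(u)τ_{u,v}⟨φ_vφ_x⟩_Λ`
(`rKernel_le_sum`). [cite: Sakai2007, Proposition 1.1 and §2.2.3] -/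
theorem Sakai2007_prop11_of_secondExpansion (h : Sakai2007_secondExpansion) : Sakai2007_prop11 := by
  intro V _ _ G _ β hβ o j x
  have h2 : SecondExpansionAt G β := h V G β hβ
  refine ⟨?_, ?_, ?_, ?_⟩
  · -- the identity (1.11), by induction on `j`
    induction j generalizing x with
    | zero =>
      have h0 := h2 univ o x
      rw [twoPointOff_of_not β (fun h => h.1 (Finset.mem_univ o)), sub_zero] at h0
      rw [h0]
      simp only [coeffSum, Finset.sum_range_one, pow_zero, one_mul, coeff, remainder,
        piKernel.eq_1, rKernel.eq_1, zero_add, pow_one]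
      ring
    | succ j ih =>
      rw [ih x]
      have hR : remainder G β o (j + 1) x = coeff G β o (j + 1) x +
          (∑ d : G.Dart, coeff G β o (j + 1) d.fst * Real.tanh β *
            isingTwoPoint G univ β 0 .free d.snd x) - remainder G β o (j + 1 + 1) x :=
        rKernel_eq_of_secondExpansionAt hβ h2 j univ o x
      have hcs : ∀ y : V, coeffSum G β o (j + 1) y =
          coeffSum G β o j y + (-1 : ℝ) ^ (j + 1) * coeff G β o (j + 1) y := fun y =>
        Finset.sum_range_succ _ _
      have e1 : ∑ d : G.Dart, (coeffSum G β o j d.fst + (-1 : ℝ) ^ (j + 1) * coeff G β o (j + 1) d.fst) *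
            Real.tanh β * isingTwoPoint G univ β 0 .free d.snd x =
          (∑ d : G.Dart, coeffSum G β o j d.fst * Real.tanh β * isingTwoPoint G univ β 0 .free d.snd x) +
            (-1 : ℝ) ^ (j + 1) * ∑ d : G.Dart, coeff G β o (j + 1) d.fst * Real.tanh β *
              isingTwoPoint G univ β 0 .free d.snd x := by
        rw [Finset.mul_sum, ← Finset.sum_add_distrib]
        exact Finset.sum_congr rfl fun d _ => by ring
      rw [hR]
      simp only [hcs]
      rw [e1, pow_succ (-1 : ℝ) (j + 1)]
      ring
  · -- `π^{(j)}(x) ≥ δ_{j,0} δ_{o,x}`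
    split_ifs with hj
    · obtain ⟨rfl, rfl⟩ := hj
      rw [coeff_zero_self]
    · exact coeff_nonneg hβ o j x
  · -- `0 ≤ R^{(j+1)}`
    exact rKernel_nonneg hβ j univ o x
  · -- `R^{(j+1)} ≤ Σ_b π^{(j)}(b̲) τ_b ⟨φ_{b̄}φ_x⟩_Λ`
    exact rKernel_le_sum hβ j univ o x

end IsingLace

end Literature.Probability.LatticeModels

end
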